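import Summits.MatrixMultiplication.OmegaCensus.STPPCountSublinear
import Literature.Barriers.MatrixMultiplication.TricoloredSumFreeBarrierEffective

/-!
# ω-census, STPP threshold function: an EFFECTIVE superlinear lower law in elementary abelian `p`-groups

HONEST FRAMING (pub-omega census; verbatim): lottery ticket; floor = certified bounds/negative ranges.
Census STRUCTURE bookkeeping (question Q7 of `STRUCTURE.md`, the threshold of `k` simultaneous-TPP triples; columns
"2-rank / elementary abelian hosts" of P-015/P-016/P-026), NOT progress on `ω` — it is the barrier side: the statement below
is the census-scale shadow of BCCGNSU 2017 Thm. A (tricolored sum-free sets in bounded-exponent groups are polynomially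
sparse).

The tree has the ineffective all-groups law `NR146` (`STPPCountSublinear.lean`: the number `N` of triples of an STPP family
with nonempty parts is `o(|G|)`, via Green's removal lemma) and the packing law `8k − 4 ≤ |G|` for `(2,2,2)^k`.  For
ELEMENTARY ABELIAN `p`-groups the tree's effective form of BCCGNSU 2017 Thm. 4.14
(`Literature.Barriers.MatrixMultiplication.card_le_rpow_of_elementary`: every tricolored sum-free set in `G` with `p·G = 0`
has at most `3·|G|^{1−c_p}` elements, `c_p` the Fox–Lovász / Kleinberg–Sawin–Speyer exponent `foxLovaszExponent p`,
`c_p ≥ δ/log p > 0` with `δ = log((2/3)·2^{2/3}) = 0.0566…`) combines with the representatives lemma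
`exists_isTricoloredSumFree_of_isSTPP` (STPP family with nonempty parts ⇒ same-size tricolored sum-free set) to give:

* `card_le_rpow_of_isSTPP_elementary` — **an STPP family of `N` triples with nonempty parts in a finite abelian group `G`
  with `p·G = 0` (`p` prime) has `N ≤ 3·|G|^{1−c_p}`**;
* `card_le_rpow_of_isSTPP_222pow_elementary` — in particular for the census pattern `(2,2,2)^k`: `k ≤ 3·|G|^{1−c_p}`, i.e.
  `|G| ≥ (k/3)^{1/(1−c_p)}` — a power saving over the linear packing law (`c₂ = 5/3 − log₂3 ≈ 0.0817`, exponent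
  `1/(1−c₂) ≈ 1.089`; `c₃ ≈ 0.0775`);
* `card_le_rpow_delta_of_isSTPP_elementary` — the closed-form weakening with `c_p` replaced by `δ/log p`;
* `card_le_rpow_of_isSTPP_zmod_pow` — the coordinate instance `G = (ℤ/p)^d`: `N ≤ 3·(p^d)^{1−c_p}`.

Reading: at census scale the constant `3` and the small exponent make the bound weak (`(2,2,2)³ ⊆ ℤ₂⁵` is allowed up to
`k = 72`), but it is the first EFFECTIVE superlinear lower law for a host class in the tree, and exactly the class the
printed barrier (BCCGNSU 2017 Thm. A/B) speaks about.  No claim for general abelian groups (there only `NR146`, ineffective).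

References: J. Blasiak, T. Church, H. Cohn, J. A. Grochow, E. Naslund, W. F. Sawin, C. Umans, Discrete Analysis 2017:3,
Def. 3.1, Thm. 4.14, Thm. A; J. Fox, L. M. Lovász, Adv. Math. 321 (2017), §1; H. Cohn, R. Kleinberg, B. Szegedy, C. Umans,
FOCS 2005, Def. 5.1.  Seat pub-omega-stpp-3 (gen 10), 2026-08-24.
-/

open Literature.Computability.AlgebraicComplexity Literature.Combinatorics.Additive
  Literature.Barriers.MatrixMultiplication Finset

namespace Summit.MatrixMultiplication.OmegaCensus

/-- **Effective lower law, elementary abelian hosts.** If `G` is a finite abelian group with `p·G = 0` (`p` prime) and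
`(Aᵢ, Bᵢ, Cᵢ)_{i<N}` is an STPP family in `G` with all parts nonempty, then `N ≤ 3·|G|^{1 − c_p}`
(`c_p = foxLovaszExponent p`): representatives give an `N`-element tricolored sum-free set
(`exists_isTricoloredSumFree_of_isSTPP`), bounded by the tree's effective BCCGNSU Thm. 4.14 (`card_le_rpow_of_elementary`).
[cite: BlasiakChurchCohnGrochowNaslundSawinUmans2017, Thm. 4.14] [cite: CohnKleinbergSzegedyUmans2005, Def. 5.1] -/
theorem card_le_rpow_of_isSTPP_elementary {p : ℕ} (hp : p.Prime) {G : Type} [AddCommGroup G] [Fintype G]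
    (hG : ∀ x : G, p • x = 0) {N : ℕ} {A B C : Fin N → Finset G} (hS : IsSTPP A B C)
    (hne : ∀ i, (A i).Nonempty ∧ (B i).Nonempty ∧ (C i).Nonempty) :
    (N : ℝ) ≤ 3 * (Fintype.card G : ℝ) ^ (1 - foxLovaszExponent p) := by
  obtain ⟨s, t, u, hT⟩ := exists_isTricoloredSumFree_of_isSTPP hS hne
  have h := card_le_rpow_of_elementary hp G hG (Fin N) s t u hT
  simpa using h

/-- **`(2,2,2)^k` in an elementary abelian `p`-group needs `k ≤ 3·|G|^{1−c_p}`** — equivalently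
`|G| ≥ (k/3)^{1/(1−c_p)}`, a superlinear effective lower law for this host class (`1/(1−c₂) ≈ 1.089`).
[cite: BlasiakChurchCohnGrochowNaslundSawinUmans2017, Thm. 4.14] [cite: CohnKleinbergSzegedyUmans2005, Def. 5.1] -/
theorem card_le_rpow_of_isSTPP_222pow_elementary {p : ℕ} (hp : p.Prime) {G : Type} [AddCommGroup G] [Fintype G]
    (hG : ∀ x : G, p • x = 0) {k : ℕ} {A B C : Fin k → Finset G} (hS : IsSTPP A B C)
    (hc : ∀ i, (A i).card = 2 ∧ (B i).card = 2 ∧ (C i).card = 2) :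
    (k : ℝ) ≤ 3 * (Fintype.card G : ℝ) ^ (1 - foxLovaszExponent p) :=
  card_le_rpow_of_isSTPP_elementary hp hG hS fun i =>
    ⟨card_pos.1 (by rw [(hc i).1]; norm_num), card_pos.1 (by rw [(hc i).2.1]; norm_num),
      card_pos.1 (by rw [(hc i).2.2]; norm_num)⟩

/-- **Closed form**: with `c_p ≥ δ/log p` (`bccgnsuDelta_div_log_le_foxLovaszExponent`, `δ = log((2/3)2^{2/3})`), an STPP
family of `N` triples with nonempty parts in a finite abelian group with `p·G = 0` has `N ≤ 3·|G|^{1 − δ/log p}`.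
[cite: BlasiakChurchCohnGrochowNaslundSawinUmans2017, Thm. A′] [cite: CohnKleinbergSzegedyUmans2005, Def. 5.1] -/
theorem card_le_rpow_delta_of_isSTPP_elementary {p : ℕ} (hp : p.Prime) {G : Type} [AddCommGroup G] [Fintype G]
    (hG : ∀ x : G, p • x = 0) {N : ℕ} {A B C : Fin N → Finset G} (hS : IsSTPP A B C)
    (hne : ∀ i, (A i).Nonempty ∧ (B i).Nonempty ∧ (C i).Nonempty) :
    (N : ℝ) ≤ 3 * (Fintype.card G : ℝ) ^ (1 - bccgnsuDelta / Real.log p) := by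
  refine le_trans (card_le_rpow_of_isSTPP_elementary hp hG hS hne) ?_
  have hG1 : (1 : ℝ) ≤ Fintype.card G := by exact_mod_cast Fintype.card_pos
  have hc := bccgnsuDelta_div_log_le_foxLovaszExponent hp.two_le
  exact mul_le_mul_of_nonneg_left (Real.rpow_le_rpow_of_exponent_le hG1 (by linarith)) (by norm_num)

/-- The coordinate instance: **an STPP family of `N` triples with nonempty parts in `(ℤ/p)^d` (`p` prime) has
`N ≤ 3·(p^d)^{1−c_p}`.** [cite: BlasiakChurchCohnGrochowNaslundSawinUmans2017, Thm. 4.14]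
[cite: CohnKleinbergSzegedyUmans2005, Def. 5.1] -/
theorem card_le_rpow_of_isSTPP_zmod_pow {p : ℕ} (hp : p.Prime) (d : ℕ) {N : ℕ}
    {A B C : Fin N → Finset (Fin d → ZMod p)} (hS : IsSTPP A B C)
    (hne : ∀ i, (A i).Nonempty ∧ (B i).Nonempty ∧ (C i).Nonempty) :
    (N : ℝ) ≤ 3 * ((p : ℝ) ^ d) ^ (1 - foxLovaszExponent p) := by
  haveI : NeZero p := ⟨hp.ne_zero⟩
  have hG : ∀ x : Fin d → ZMod p, p • x = 0 := fun x => by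
    funext i
    simp [nsmul_eq_mul]
  have h := card_le_rpow_of_isSTPP_elementary hp hG hS hne
  have hcard : (Fintype.card (Fin d → ZMod p) : ℝ) = (p : ℝ) ^ d := by
    rw [Fintype.card_pi, Finset.prod_const, ZMod.card, Finset.card_univ, Fintype.card_fin]
    push_cast
    rfl
  rwa [hcard] at h

/-! ## APPEND (gen 10, same seat): bounded exponent — the census form of BCCGNSU 2017 Thm. A

The tree PROVES Thm. A itself (`BCCGNSU2017_thmA_holds`, `TricoloredSumFreeBarrierProofs.lean`): in a finite abelian group
`H` generated by elements of order `≤ m` — in particular one of exponent `≤ m` (`BCCGNSU2017_thmA.of_exponent_le`) — every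
tricolored sum-free set has at most `3·|H|^{1−ε/m}` elements, `ε = bccgnsuEpsilon = ½·log((2/3)2^{2/3}) = 0.02831…`.  With the
representatives lemma this is a lower law for EVERY bounded-exponent host class:

* `card_le_rpow_of_isSTPP_exponent_le` — **an STPP family of `N` triples with nonempty parts in a finite abelian group of
  exponent `≤ m` has `N ≤ 3·|G|^{1 − ε/m}`**; `(2,2,2)^k` form `card_le_rpow_of_isSTPP_222pow_exponent_le`
  (`|G| ≥ (k/3)^{1/(1−ε/m)}`: exponent `2 ↦ 1.0144`, `4 ↦ 1.0071`, `6 ↦ 1.0047`, … — numerically weaker than the prime case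
  `c_p` above, but valid for every exponent, e.g. the census's `ℤ₂^a × ℤ₄^b`, `ℤ₃^a × ℤ₉^b` hosts).
No claim beyond the tree's Thm. A; ineffective-free. -/

/-- **Bounded-exponent lower law (census form of BCCGNSU 2017 Thm. A).** If `G` is a finite abelian group of exponent `≤ m`
and `(Aᵢ, Bᵢ, Cᵢ)_{i<N}` is an STPP family in `G` with all parts nonempty, then `N ≤ 3·|G|^{1 − ε/m}` with
`ε = bccgnsuEpsilon`. [cite: BlasiakChurchCohnGrochowNaslundSawinUmans2017, Thm. A]
[cite: CohnKleinbergSzegedyUmans2005, Def. 5.1] -/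
theorem card_le_rpow_of_isSTPP_exponent_le {G : Type} [AddCommGroup G] [Fintype G] {m : ℕ}
    (hm : AddMonoid.exponent G ≤ m) {N : ℕ} {A B C : Fin N → Finset G} (hS : IsSTPP A B C)
    (hne : ∀ i, (A i).Nonempty ∧ (B i).Nonempty ∧ (C i).Nonempty) :
    (N : ℝ) ≤ 3 * (Fintype.card G : ℝ) ^ (1 - bccgnsuEpsilon / m) := by
  obtain ⟨s, t, u, hT⟩ := exists_isTricoloredSumFree_of_isSTPP hS hne
  have h := BCCGNSU2017_thmA_holds.of_exponent_le G hm (Fin N) s t u hT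
  simpa using h

/-- **`(2,2,2)^k` in a finite abelian group of exponent `≤ m` needs `k ≤ 3·|G|^{1−ε/m}`.**
[cite: BlasiakChurchCohnGrochowNaslundSawinUmans2017, Thm. A] [cite: CohnKleinbergSzegedyUmans2005, Def. 5.1] -/
theorem card_le_rpow_of_isSTPP_222pow_exponent_le {G : Type} [AddCommGroup G] [Fintype G] {m : ℕ}
    (hm : AddMonoid.exponent G ≤ m) {k : ℕ} {A B C : Fin k → Finset G} (hS : IsSTPP A B C)
    (hc : ∀ i, (A i).card = 2 ∧ (B i).card = 2 ∧ (C i).card = 2) :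
    (k : ℝ) ≤ 3 * (Fintype.card G : ℝ) ^ (1 - bccgnsuEpsilon / m) :=
  card_le_rpow_of_isSTPP_exponent_le hm hS fun i =>
    ⟨card_pos.1 (by rw [(hc i).1]; norm_num), card_pos.1 (by rw [(hc i).2.1]; norm_num),
      card_pos.1 (by rw [(hc i).2.2]; norm_num)⟩

end Summit.MatrixMultiplication.OmegaCensus
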